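import Summits.ValiantsHypothesis.ValiantsHypothesis.Theorems.KPlusLogSqLawTridiagonalRealStaticPumpHarvestPos

/-!
# Route «KPlusLogSqLaw», crux `WeakLifting` (stmt-ValiantsHypothesis-19561) — REAL side of the tridiagonal sector:
# HARVESTING THE PUMP, part 2 (orientation `ρ = −1`, and the assembly over `pump_iter`)

HONEST FRAMING.  Helper (`--supports stmt-ValiantsHypothesis-19561 --as helper`), seat val-sym-lift-p1 (g12), cell `pub-symmetroid`,
2026-08-27.  `pump_harvest_neg`: for the states of `…PumpIter` in reflected coordinates (`ρ = −1`, `μ = s`, actual points `u = −z`) one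
edge of type I (vertex `X⁰`, link `√κ·X^f`, from `exists_move_signs_sq_sep`) switching at the junction `M` makes `D_{k+5}` follow `−D_{k+3}` on
one cluster and `D_{k+4}` on the other (no transition zero in this orientation): `|R| + |T| + 3` certified alternations along the negated
reverse of `x₁ :: R ++ M :: T ++ [y]`.  `pump_harvest`: for EVERY `k`, data `e, b, f` of a static definite tridiagonal `(k+5) × (k+5)`
design and a strictly increasing list of at least `2k + 4` positive points along which `D_{k+5}` alternates — i.e. `≥ 2k + 3 = 2(k+5) − 7`
distinct positive zeros (realised as matrices in `…Pump`).  Nothing here is an upper bound; nothing bears on `WeakLifting` / `TropicalB` in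
their windows, Conjecture B, the doors, `MatrixDescartes` (stmt-18050) or VP ≠ VNP.  [mechanism: val-sym-lift-p3 g9's pump-and-harvest; folklore]
-/

-- `Summit.ValiantsHypothesis.ValiantsHypothesis.…` repeats a component by the D-0017 layout (single-conjunct summit); the name is mandated.
set_option linter.dupNamespace false
set_option autoImplicit false

namespace Summit.ValiantsHypothesis.ValiantsHypothesis.Theorems.KPlusLogSqLaw.StaticTridiagonalRealLadder

open Polynomial
open Summit.ValiantsHypothesis.ValiantsHypothesis.Theorems.ValuativeFlip (ctK ctPath ctPath_apply ctK_zero ctK_one ctK_add_two)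
open Summit.ValiantsHypothesis.ValiantsHypothesis.Theorems.KPlusLogSqLaw.StaticTridiagonalRealExcess (exists_move_signs)

/-- **HARVEST, orientation `ρ = −1`** (the state is in reflected coordinates, actual points `u = −z`; `μ = s`): one edge of type I
(`X⁰` vertex, `√κ·X^f` link) switching at the junction gives `D_{k+5}` with `|R| + |T| + 3` certified alternations along the negated
reverse of `x₁ :: R ++ M :: T ++ [y]`. [mechanism: val-sym-lift-p3 g9's harvest; folklore analysis] -/
theorem pump_harvest_neg (k : ℕ) {e : ℕ → ℕ} {b : ℕ → ℝ} {f : ℕ → ℕ} {s μ P0 x x₁ M y y₁ P1 : ℝ} {R T : List ℝ}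
    (hs : μ = s) (hP1 : P1 < 0)
    (c1 : (P0 :: x :: x₁ :: (R ++ M :: (T ++ [y, y₁, P1]))).IsChain (· < ·))
    (c2e : s * (fun z : ℝ => (((ctPath (fun t => (X : ℝ[X]) ^ e t) (fun t => C (b t) * X ^ f t) (fun t => C (b (t - 1)) * X ^ f (t - 1)) (k + 4))).det).eval ((-1) * z)) M < 0)
    (c2f : (M :: (T ++ [y])).IsChain (fun u v => (fun z : ℝ => (((ctPath (fun t => (X : ℝ[X]) ^ e t) (fun t => C (b t) * X ^ f t) (fun t => C (b (t - 1)) * X ^ f (t - 1)) (k + 4))).det).eval ((-1) * z)) u * (fun z : ℝ => (((ctPath (fun t => (X : ℝ[X]) ^ e t) (fun t => C (b t) * X ^ f t) (fun t => C (b (t - 1)) * X ^ f (t - 1)) (k + 4))).det).eval ((-1) * z)) v < 0))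
    (c2g : μ * (fun z : ℝ => (((ctPath (fun t => (X : ℝ[X]) ^ e t) (fun t => C (b t) * X ^ f t) (fun t => C (b (t - 1)) * X ^ f (t - 1)) (k + 4))).det).eval ((-1) * z)) y < 0)
    (c3c : s * (fun z : ℝ => (((ctPath (fun t => (X : ℝ[X]) ^ e t) (fun t => C (b t) * X ^ f t) (fun t => C (b (t - 1)) * X ^ f (t - 1)) (k + 3))).det).eval ((-1) * z)) x₁ < 0)
    (c3d : (x₁ :: (R ++ [M])).IsChain (fun u v => (fun z : ℝ => (((ctPath (fun t => (X : ℝ[X]) ^ e t) (fun t => C (b t) * X ^ f t) (fun t => C (b (t - 1)) * X ^ f (t - 1)) (k + 3))).det).eval ((-1) * z)) u * (fun z : ℝ => (((ctPath (fun t => (X : ℝ[X]) ^ e t) (fun t => C (b t) * X ^ f t) (fun t => C (b (t - 1)) * X ^ f (t - 1)) (k + 3))).det).eval ((-1) * z)) v < 0))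
    (c3e : 0 < μ * (fun z : ℝ => (((ctPath (fun t => (X : ℝ[X]) ^ e t) (fun t => C (b t) * X ^ f t) (fun t => C (b (t - 1)) * X ^ f (t - 1)) (k + 3))).det).eval ((-1) * z)) M)
    (c4 : (∀ z ∈ Set.Icc P0 x₁, s * (fun z : ℝ => (((ctPath (fun t => (X : ℝ[X]) ^ e t) (fun t => C (b t) * X ^ f t) (fun t => C (b (t - 1)) * X ^ f (t - 1)) (k + 3))).det).eval ((-1) * z)) z < 0))
    (c5 : (∀ z ∈ Set.Icc y P1, μ * (fun z : ℝ => (((ctPath (fun t => (X : ℝ[X]) ^ e t) (fun t => C (b t) * X ^ f t) (fun t => C (b (t - 1)) * X ^ f (t - 1)) (k + 4))).det).eval ((-1) * z)) z < 0)) :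
    ∃ (e' : ℕ → ℕ) (b' : ℕ → ℝ) (f' : ℕ → ℕ) (Λ : List ℝ),
      Λ.IsChain (· < ·) ∧ (∀ u ∈ Λ, 0 < u) ∧ R.length + T.length + 3 ≤ Λ.length ∧
      Λ.IsChain (fun u v => (((ctPath (fun t => (X : ℝ[X]) ^ e' t) (fun t => C (b' t) * X ^ f' t) (fun t => C (b' (t - 1)) * X ^ f' (t - 1)) (k + 5))).det).eval u * (((ctPath (fun t => (X : ℝ[X]) ^ e' t) (fun t => C (b' t) * X ^ f' t) (fun t => C (b' (t - 1)) * X ^ f' (t - 1)) (k + 5))).det).eval v < 0) := by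
  -- list surgery on the sample list
  have c1s : ((P0 :: x :: x₁ :: R) ++ M :: (T ++ [y, y₁, P1])).IsChain (· < ·) := c1
  have cleft : ((P0 :: x :: x₁ :: R) ++ [M]).IsChain (· < ·) := (List.isChain_split.mp c1s).1
  have cright : (M :: (T ++ [y, y₁, P1])).IsChain (· < ·) := (List.isChain_split.mp c1s).2
  have cleft' : (x₁ :: (R ++ [M])).IsChain (· < ·) :=
    (List.isChain_cons_cons.mp (List.isChain_cons_cons.mp cleft).2).2
  have hltM : ∀ u ∈ P0 :: x :: x₁ :: R, u < M := lt_last_of_isChain cleft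
  have cright' : ((M :: (T ++ [y])) ++ [y₁, P1]).IsChain (· < ·) := by simpa using cright
  have cMTy : (M :: (T ++ [y])).IsChain (· < ·) := cright'.left_of_append
  have hMlt : ∀ u ∈ T ++ [y, y₁, P1], M < u := fun u hu =>
    (List.pairwise_cons.mp (List.isChain_iff_pairwise.mp cright)).1 u hu
  have cyyP : (y :: [y₁, P1]).IsChain (· < ·) := (List.isChain_split.mp (List.isChain_cons.mp cright).2).2
  have hyy₁ : y < y₁ := (List.isChain_cons_cons.mp cyyP).1
  have hy₁P1 : y₁ < P1 := (List.isChain_cons_cons.mp (List.isChain_cons_cons.mp cyyP).2).1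
  have o1 : P0 < x := (List.isChain_cons_cons.mp c1).1
  have o2 : x < x₁ := (List.isChain_cons_cons.mp (List.isChain_cons_cons.mp c1).2).1
  have hleP1 := le_last_of_isChain c1
  -- non-vanishing facts
  have hGne : ∀ P ∈ M :: (T ++ [y, y₁, P1]), (fun z : ℝ => (((ctPath (fun t => (X : ℝ[X]) ^ e t) (fun t => C (b t) * X ^ f t) (fun t => C (b (t - 1)) * X ^ f (t - 1)) (k + 4))).det).eval ((-1) * z)) P ≠ 0 := by
    intro P hP
    simp only [List.mem_cons, List.mem_append, List.mem_nil_iff, or_false] at hP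
    rcases hP with hP | hP | hP | hP | hP
    · rw [hP]; intro h0; rw [h0, mul_zero] at c2e; exact lt_irrefl _ c2e
    · exact ne_zero_of_isChain_alt₂ c2f (by simp) P (by simp [hP])
    · rw [hP]; intro h0; rw [h0, mul_zero] at c2g; exact lt_irrefl _ c2g
    · rw [hP]; intro h0; have := c5 y₁ ⟨hyy₁.le, hy₁P1.le⟩; rw [h0, mul_zero] at this; exact lt_irrefl _ this
    · rw [hP]; intro h0; have := c5 P1 ⟨(hyy₁.trans hy₁P1).le, le_rfl⟩; rw [h0, mul_zero] at this; exact lt_irrefl _ this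
  have hFne : ∀ P ∈ P0 :: x :: x₁ :: (R ++ [M]), (fun z : ℝ => (((ctPath (fun t => (X : ℝ[X]) ^ e t) (fun t => C (b t) * X ^ f t) (fun t => C (b (t - 1)) * X ^ f (t - 1)) (k + 3))).det).eval ((-1) * z)) P ≠ 0 := by
    intro P hP
    simp only [List.mem_cons, List.mem_append, List.mem_nil_iff, or_false] at hP
    rcases hP with hP | hP | hP | hP | hP
    · rw [hP]; intro h0; have := c4 P0 ⟨le_rfl, (o1.trans o2).le⟩; rw [h0, mul_zero] at this; exact lt_irrefl _ this
    · rw [hP]; intro h0; have := c4 x ⟨o1.le, o2.le⟩; rw [h0, mul_zero] at this; exact lt_irrefl _ this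
    · rw [hP]; intro h0; rw [h0, mul_zero] at c3c; exact lt_irrefl _ c3c
    · exact ne_zero_of_isChain_alt₂ c3d (by simp) P (by simp [hP])
    · rw [hP]; intro h0; rw [h0, mul_zero] at c3e; exact lt_irrefl _ c3e
  have hneg : ∀ u ∈ (P0 :: x :: x₁ :: (R ++ M :: (T ++ [y, y₁, P1]))), 0 < -u := fun u hu => by linarith [hleP1 u hu]
  obtain ⟨fe, κ, hκ, hl, hr⟩ := exists_move_signs_sq_sep (fun u => (((ctPath (fun t => (X : ℝ[X]) ^ e t) (fun t => C (b t) * X ^ f t) (fun t => C (b (t - 1)) * X ^ f (t - 1)) (k + 4))).det).eval u) (fun u => (((ctPath (fun t => (X : ℝ[X]) ^ e t) (fun t => C (b t) * X ^ f t) (fun t => C (b (t - 1)) * X ^ f (t - 1)) (k + 3))).det).eval u)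
    ((M :: (T ++ [y, y₁, P1])).toFinset.image (fun z : ℝ => -z)) ((P0 :: x :: x₁ :: R).toFinset.image (fun z : ℝ => -z))
    ⟨-M, Finset.mem_image.mpr ⟨M, by simp, rfl⟩⟩ ⟨-P0, Finset.mem_image.mpr ⟨P0, by simp, rfl⟩⟩
    (fun a ha => by
      obtain ⟨P, hP, rfl⟩ := Finset.mem_image.mp ha
      rw [List.mem_toFinset] at hP
      refine ⟨hneg P (mem_full_of_right hP), ?_⟩
      have := hGne P hP
      simpa using this)
    (fun u hu => by
      obtain ⟨P, hP, rfl⟩ := Finset.mem_image.mp hu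
      rw [List.mem_toFinset] at hP
      have := hFne P (mem_left_of_short hP)
      simpa using this)
    (fun a ha u hu => by
      obtain ⟨P, hP, rfl⟩ := Finset.mem_image.mp ha
      obtain ⟨Q, hQ, rfl⟩ := Finset.mem_image.mp hu
      rw [List.mem_toFinset] at hP hQ
      have h1 : Q < M := hltM Q hQ
      have h2 : M ≤ P := by
        rcases List.mem_cons.mp hP with hP | hP
        · rw [hP]
        · exact (hMlt P hP).le
      linarith)
  -- the harvested continuant
  obtain ⟨e', he'⟩ : ∃ e' : ℕ → ℕ, e' = fun t => if t < k + 4 then e t else 0 := ⟨_, rfl⟩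
  obtain ⟨b', hb'⟩ : ∃ b' : ℕ → ℝ, b' = fun t => if t < k + 3 then b t else Real.sqrt κ := ⟨_, rfl⟩
  obtain ⟨f', hf'⟩ : ∃ f' : ℕ → ℕ, f' = fun t => if t < k + 3 then f t else fe := ⟨_, rfl⟩
  have hagree : ∀ n, n ≤ k + 4 → (ctPath (fun t => (X : ℝ[X]) ^ e' t) (fun t => C (b' t) * X ^ f' t) (fun t => C (b' (t - 1)) * X ^ f' (t - 1)) n) = (ctPath (fun t => (X : ℝ[X]) ^ e t) (fun t => C (b t) * X ^ f t) (fun t => C (b (t - 1)) * X ^ f (t - 1)) n) := by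
    intro n hn
    refine ctPath_congr_edata (fun t ht => ?_) (fun t ht => ?_) (fun t ht => ?_)
    · rw [he']; simp only [show t < k + 4 by omega, if_true]
    · rw [hb']; simp only [show t < k + 3 by omega, if_true]
    · rw [hf']; simp only [show t < k + 3 by omega, if_true]
  have hD5 : ∀ u : ℝ, (((ctPath (fun t => (X : ℝ[X]) ^ e' t) (fun t => C (b' t) * X ^ f' t) (fun t => C (b' (t - 1)) * X ^ f' (t - 1)) (k + 5))).det).eval u =
      (((ctPath (fun t => (X : ℝ[X]) ^ e t) (fun t => C (b t) * X ^ f t) (fun t => C (b (t - 1)) * X ^ f (t - 1)) (k + 4))).det).eval u - κ * u ^ (2 * fe) * (((ctPath (fun t => (X : ℝ[X]) ^ e t) (fun t => C (b t) * X ^ f t) (fun t => C (b (t - 1)) * X ^ f (t - 1)) (k + 3))).det).eval u := by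
    intro u
    have h := eval_det_epath_add_two e' b' f' (k + 3) u
    have h1 : e' (k + 3 + 1) = 0 := by rw [he']; simp
    have h2 : b' (k + 3) ^ 2 = κ := by rw [hb']; simp only [lt_irrefl, if_false]; exact Real.sq_sqrt hκ.le
    have h3 : f' (k + 3) = fe := by rw [hf']; simp
    have h4 : (((ctPath (fun t => (X : ℝ[X]) ^ e' t) (fun t => C (b' t) * X ^ f' t) (fun t => C (b' (t - 1)) * X ^ f' (t - 1)) (k + 3 + 1))).det).eval u = (((ctPath (fun t => (X : ℝ[X]) ^ e t) (fun t => C (b t) * X ^ f t) (fun t => C (b (t - 1)) * X ^ f (t - 1)) (k + 4))).det).eval u := by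
      rw [hagree _ (by omega)]
    have h5 : (((ctPath (fun t => (X : ℝ[X]) ^ e' t) (fun t => C (b' t) * X ^ f' t) (fun t => C (b' (t - 1)) * X ^ f' (t - 1)) (k + 3))).det).eval u = (((ctPath (fun t => (X : ℝ[X]) ^ e t) (fun t => C (b t) * X ^ f t) (fun t => C (b (t - 1)) * X ^ f (t - 1)) (k + 3))).det).eval u := by
      rw [hagree _ (by omega)]
    rw [h1, h2, h3, h4, h5, pow_zero, one_mul] at h
    exact h
  -- signs in state coordinates (`φ z = D_{k+5}(−z)`): `−F` on `P0, x, x₁, R`, `G` on `M, T, y, y₁, P1`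
  have sL : ∀ a ∈ P0 :: x :: x₁ :: R, 0 < (-1) * ((fun z : ℝ => (((ctPath (fun t => (X : ℝ[X]) ^ e t) (fun t => C (b t) * X ^ f t) (fun t => C (b (t - 1)) * X ^ f (t - 1)) (k + 3))).det).eval ((-1) * z)) a * (((ctPath (fun t => (X : ℝ[X]) ^ e' t) (fun t => C (b' t) * X ^ f' t) (fun t => C (b' (t - 1)) * X ^ f' (t - 1)) (k + 5))).det).eval (-a)) := by
    intro a ha
    have := hr (-a) (Finset.mem_image.mpr ⟨a, List.mem_toFinset.mpr ha, rfl⟩)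
    rw [hD5]
    simp only [neg_mul, one_mul] at this ⊢
    linarith
  have sR : ∀ u ∈ M :: (T ++ [y, y₁, P1]), 0 < 1 * ((fun z : ℝ => (((ctPath (fun t => (X : ℝ[X]) ^ e t) (fun t => C (b t) * X ^ f t) (fun t => C (b (t - 1)) * X ^ f (t - 1)) (k + 4))).det).eval ((-1) * z)) u * (((ctPath (fun t => (X : ℝ[X]) ^ e' t) (fun t => C (b' t) * X ^ f' t) (fun t => C (b' (t - 1)) * X ^ f' (t - 1)) (k + 5))).det).eval (-u)) := by
    intro u hu
    have := hl (-u) (Finset.mem_image.mpr ⟨u, List.mem_toFinset.mpr hu, rfl⟩)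
    rw [hD5]
    simp only [neg_mul, one_mul] at this ⊢
    linarith
  -- the state-coordinate list and its reflection
  have hchain : (x₁ :: (R ++ M :: (T ++ [y]))).IsChain
      (fun u v => (((ctPath (fun t => (X : ℝ[X]) ^ e' t) (fun t => C (b' t) * X ^ f' t) (fun t => C (b' (t - 1)) * X ^ f' (t - 1)) (k + 5))).det).eval (-u) * (((ctPath (fun t => (X : ℝ[X]) ^ e' t) (fun t => C (b' t) * X ^ f' t) (fun t => C (b' (t - 1)) * X ^ f' (t - 1)) (k + 5))).det).eval (-v) < 0) := by
    have e1 : x₁ :: (R ++ M :: (T ++ [y])) = (x₁ :: R) ++ M :: (T ++ [y]) := rfl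
    rw [e1, List.isChain_split]
    constructor
    · refine (isChain_alt_congr (c := -1) ?_).mp c3d
      intro a ha
      have ha' : a ∈ (x₁ :: R) ++ [M] := by simpa using ha
      rcases List.mem_append.mp ha' with ha' | ha'
      · exact sL a (List.mem_cons_of_mem _ (List.mem_cons_of_mem _ ha'))
      · rw [List.mem_singleton.mp ha']
        -- at `M` the harvested continuant follows `G`, and `G M`, `F M` have opposite signs (`μ = s`)
        have hFM : 0 < s * (fun z : ℝ => (((ctPath (fun t => (X : ℝ[X]) ^ e t) (fun t => C (b t) * X ^ f t) (fun t => C (b (t - 1)) * X ^ f (t - 1)) (k + 3))).det).eval ((-1) * z)) M := by rw [← hs]; exact c3e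
        have h2 : 0 < (fun z : ℝ => (((ctPath (fun t => (X : ℝ[X]) ^ e t) (fun t => C (b t) * X ^ f t) (fun t => C (b (t - 1)) * X ^ f (t - 1)) (k + 4))).det).eval ((-1) * z)) M * (((ctPath (fun t => (X : ℝ[X]) ^ e' t) (fun t => C (b' t) * X ^ f' t) (fun t => C (b' (t - 1)) * X ^ f' (t - 1)) (k + 5))).det).eval (-M) := by
          have := sR M (by simp); linarith
        have hφM : 0 < (-s) * (((ctPath (fun t => (X : ℝ[X]) ^ e' t) (fun t => C (b' t) * X ^ f' t) (fun t => C (b' (t - 1)) * X ^ f' (t - 1)) (k + 5))).det).eval (-M) :=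
          sgn_of_mul_pos (a := (((ctPath (fun t => (X : ℝ[X]) ^ e' t) (fun t => C (b' t) * X ^ f' t) (fun t => C (b' (t - 1)) * X ^ f' (t - 1)) (k + 5))).det).eval (-M)) (b := (fun z : ℝ => (((ctPath (fun t => (X : ℝ[X]) ^ e t) (fun t => C (b t) * X ^ f t) (fun t => C (b (t - 1)) * X ^ f (t - 1)) (k + 4))).det).eval ((-1) * z)) M)
            (by linarith [mul_comm ((fun z : ℝ => (((ctPath (fun t => (X : ℝ[X]) ^ e t) (fun t => C (b t) * X ^ f t) (fun t => C (b (t - 1)) * X ^ f (t - 1)) (k + 4))).det).eval ((-1) * z)) M) ((((ctPath (fun t => (X : ℝ[X]) ^ e' t) (fun t => C (b' t) * X ^ f' t) (fun t => C (b' (t - 1)) * X ^ f' (t - 1)) (k + 5))).det).eval (-M))]) (by linarith [c2e])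
        have := mul_neg_of_sgn (t := s) hFM (by linarith : s * (((ctPath (fun t => (X : ℝ[X]) ^ e' t) (fun t => C (b' t) * X ^ f' t) (fun t => C (b' (t - 1)) * X ^ f' (t - 1)) (k + 5))).det).eval (-M) < 0)
        linarith
    · refine (isChain_alt_congr (c := 1) ?_).mp c2f
      intro u hu
      exact sR u (mem_right_of_short hu)
  refine ⟨e', b', f', (x₁ :: (R ++ M :: (T ++ [y]))).reverse.map (fun z : ℝ => -z), ?_, ?_, by simp; omega, ?_⟩
  · -- strictly increasing
    apply isChain_lt_reverse_neg
    have e1 : x₁ :: (R ++ M :: (T ++ [y])) = (x₁ :: R) ++ M :: (T ++ [y]) := rfl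
    rw [e1, List.isChain_split]
    exact ⟨cleft', cMTy⟩
  · intro u hu
    have := hneg (-u) (mem_full_of_mid (mem_reverse_neg hu))
    simpa using this
  · have := isChain_alt_reverse_neg (fun z => (((ctPath (fun t => (X : ℝ[X]) ^ e' t) (fun t => C (b' t) * X ^ f' t) (fun t => C (b' (t - 1)) * X ^ f' (t - 1)) (k + 5))).det).eval (-z)) hchain
    refine (List.IsChain.iff (fun u v => ?_)).mp this
    simp only [neg_neg]

/-- **THE HARVEST** (module docstring): after `k` pump moves, ONE more hierarchical edge switching at the junction `M` of the two clusters
yields data `e, b, f` of a static definite tridiagonal `(k+5) × (k+5)` design and a strictly increasing list of at least `2k + 4` positive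
points along which `D_{k+5}` alternates in sign. [mechanism: val-sym-lift-p3 g9's pump-and-harvest; folklore analysis] -/
theorem pump_harvest (k : ℕ) : ∃ (e : ℕ → ℕ) (b : ℕ → ℝ) (f : ℕ → ℕ) (Λ : List ℝ),
    Λ.IsChain (· < ·) ∧ (∀ u ∈ Λ, 0 < u) ∧ 2 * k + 4 ≤ Λ.length ∧
    Λ.IsChain (fun u v => (((ctPath (fun t => (X : ℝ[X]) ^ e t) (fun t => C (b t) * X ^ f t) (fun t => C (b (t - 1)) * X ^ f (t - 1)) (k + 5))).det).eval u * (((ctPath (fun t => (X : ℝ[X]) ^ e t) (fun t => C (b t) * X ^ f t) (fun t => C (b (t - 1)) * X ^ f (t - 1)) (k + 5))).det).eval v < 0) := by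
  obtain ⟨e, b, f, ρ, s, μ, P0, x, x₁, R, M, T, y, y₁, P1, hρ, hμ, hρP0, hρP1, hlen,
    c1, -, -, -, -, c2e, c2f, c2g, c3c, c3d, c3e, -, -, -, -, c4, c5⟩ := pump_iter k
  rcases hρ with rfl | rfl
  · obtain ⟨e', b', f', Λ, h1, h2, h3, h4⟩ := pump_harvest_pos k (by rw [hμ]; ring) (by linarith)
      c1 c2e c2f c2g c3c c3d c3e c4 c5
    exact ⟨e', b', f', Λ, h1, h2, by omega, h4⟩
  · obtain ⟨e', b', f', Λ, h1, h2, h3, h4⟩ := pump_harvest_neg k (by rw [hμ]; ring) (by linarith)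
      c1 c2e c2f c2g c3c c3d c3e c4 c5
    exact ⟨e', b', f', Λ, h1, h2, by omega, h4⟩

end Summit.ValiantsHypothesis.ValiantsHypothesis.Theorems.KPlusLogSqLaw.StaticTridiagonalRealLadder
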